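import Summits.ResolutionOfSingularities.ResolutionOfSingularities.Theorems.SpreadCutCells
import Summits.ResolutionOfSingularities.ResolutionOfSingularities.Theorems.MaxContactCutCylinderCut
import HarnessLib

/-!
# MaxContactCutSpreadCut — the decomp-res node «SpreadCut» BY NAME on the host route `MaxContactCut` (lens-2 g19, pin b2959d31)

Content VERBATIM from the decomp-res lens-2 g19 node `HOME/decomp-res-lens-2/g19/SpreadCut.lean` (pin b2959d31, 3
579 l; HOME = run/shared/lean/pub/decomp-res);
CRITIC-LEDGER row 155 (DECIDED-MOD-PORT +1); landing orders INBOX :540: l. 143–2878 are `CylinderCut` d60dded1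
VERBATIM (landed as `CylinderCutClasses` · `CylinderCutCells` ·
`MaxContactCutCylinderCut`) and are DELETED here with the landed modules imported instead (namespaces
`…Theorems.PinchCut` / `JetCut` / `PurityCut` / `SplitCut` / `CylinderCut`
opened; same short names, byte-identical bodies — never two copies); NEW = §Γ (l. 2880–3336, the ring-level law +
§Γ.3 point level) and §V (l. 3338–3576, the spread cut).
Namespace `…Theorems.SpreadCut` (the lens's `Theses.SpreadCut` is gate-reserved), sub-namespace `Spread` as in the
lens; file split only (tree files ≤ 400 lines): sections,
variables, the `open MvPolynomial` lines and every declaration exactly as in the lens; the node's global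
dupNamespace-linter line dropped.  Node files, in import order:
`SpreadCutLaw` (§Γ + the cone-free head of §V; continued `…2` / `…3` where the cap cuts) · `SpreadCutCells` (§V2–§V4
cone-free: the aside home) · the wiring `MaxContactCutSpreadCut`
(§V BY NAME on the host route, in the Theses cone).  All `--supports stmt-ResolutionOfSingularities-29273`
(`MaxContactCut.RungOne`); nothing closes 29273 — decided halves
carry their engines as hypotheses (`SpreadExit` is a paper engine, not an item); exactly ONE located-residual aside
on the lens-2 column (`Spread.SpreadSpecialRung`, home
`SpreadCutCells`) SUPERSEDES g18's `Cyl.CylSpecialRung`, re-located EXACTLY modulo the spread decided half.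

THE WIRING of the node VERBATIM, BY NAME on the host route `MaxContactCut` (in the Theses cone), in lens order:
`Spread.rungOne_iff : MaxContactCut.RungOne ⟺ SpreadGenericRung ∧ SpreadSpecialRung`, **`Spread.closes`**,
`spreadGenericRung_of_ports`, `closes_of_engines`, and the §V4 EXACT re-locations
(**`cylSpecialRung_iff_spreadSpecialRung`**: g18's residual ⟺ the spread residual modulo the decided half; then
split / grand / vast / pinch and the tree aside 33866 `MaxContactCut.LeafSpecialRung`) — 0 sorry.  Imports the aside
home `SpreadCutCells` and `MaxContactCutCylinderCut`.  Supports 29273.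

This file carries: `Spread.rungOne_iff`, `Spread.spreadGenericRung_of_rungOne`,
`Spread.spreadSpecialRung_of_rungOne`, `Spread.spreadSpecialRung_iff_rungOne`, `Spread.closes`,
`Spread.spreadGenericRung_of_ports`, `Spread.closes_of_engines`, `Spread.cylSpecialRung_iff_spreadSpecialRung`,
`Spread.splitSpecialRung_iff_spreadSpecialRung`, `Spread.grandSpecialRung_iff_spreadSpecialRung`,
`Spread.vastSpecialRung_iff_spreadSpecialRung`, `Spread.leafSpecialRung_iff_spreadSpecialRung`,
`Spread.leafGenericRung_of_spreadGenericRung`, `Spread.pinchSpecialRung_iff_spreadSpecialRung`,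
`Spread.closes_of_cylSpecialRung`, `Spread.cyl_closes_of_spread`.

(Sources: Hironaka1964 Ch. III; CossartJannsenSaito2020 Ch. 2, Ch. 8–9; CossartPiltant2008 Prop. 4.2;
CossartPiltant2019 Rem. 3.2; BierstoneGrigorievMilmanWlodarczyk2011 §3.1; Moh1987; Hauser2010Kangaroo; Giraud1975;
Narasimhan1983.)
-/

open CategoryTheory AlgebraicGeometry TopologicalSpace IsLocalRing
open Literature.AlgebraicGeometry.Resolution
open Summit.ResolutionOfSingularities.ResolutionOfSingularities.Theorems
open Summit.ResolutionOfSingularities.ResolutionOfSingularities.Theorems.WeakOrderReduction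
open Summit.ResolutionOfSingularities.ResolutionOfSingularities.Theorems.DeltaFaceCutClasses
open Summit.ResolutionOfSingularities.ResolutionOfSingularities.Theorems.RelativeDeltaCut
open Summit.ResolutionOfSingularities.ResolutionOfSingularities.Theorems.CurveLeafExit
open Summit.ResolutionOfSingularities.ResolutionOfSingularities.Theorems.PinchCut
open Summit.ResolutionOfSingularities.ResolutionOfSingularities.Theorems.JetCut
open Summit.ResolutionOfSingularities.ResolutionOfSingularities.Theorems.PurityCut
open Summit.ResolutionOfSingularities.ResolutionOfSingularities.Theorems.SplitCut
open Summit.ResolutionOfSingularities.ResolutionOfSingularities.Theorems.CylinderCut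
open MvPolynomial
open Summit.ResolutionOfSingularities.ResolutionOfSingularities.Theses

namespace Summit.ResolutionOfSingularities.ResolutionOfSingularities.Theorems.SpreadCut

namespace Spread

section Kernels

variable {n : ℕ}

/-- **EXACT AT THE RUNG**: `RungOne ⟺ SpreadGenericRung ∧ SpreadSpecialRung`. [folklore] -/
theorem rungOne_iff : MaxContactCut.RungOne ↔ SpreadGenericRung ∧ SpreadSpecialRung :=
  Leaf.rungOne_iff (L := spreadLeaf)

/-- NECESSITY by letter. [folklore] -/
theorem spreadGenericRung_of_rungOne (h : MaxContactCut.RungOne) : SpreadGenericRung := (rungOne_iff.mp h).1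

/-- NECESSITY by letter. [folklore] -/
theorem spreadSpecialRung_of_rungOne (h : MaxContactCut.RungOne) : SpreadSpecialRung := (rungOne_iff.mp h).2

/-- HONESTY KERNEL: modulo the decided half, the located residual IS the rung (cofinal). [folklore] -/
theorem spreadSpecialRung_iff_rungOne (hG : SpreadGenericRung) : SpreadSpecialRung ↔ MaxContactCut.RungOne :=
  Leaf.specialRung_iff_rungOne (L := spreadLeaf) hG

/-- **DECIDING IMPLICATION OF THE NODE**: `MaxContactCut.RungOne` (29273) BY NAME from the two halves. [folklore] -/
theorem closes (hG : SpreadGenericRung) (hS : SpreadSpecialRung) : MaxContactCut.RungOne :=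
  Leaf.closes (L := spreadLeaf) hG hS

/-- **`SpreadGenericRung` with the cylinder engine DISCHARGED by the ports**: (JCyl) and (Γ) decided on paper, X1
via the TREE aside 30081
`MaxContactCut.MaxOrderThreefoldResolution` BY NAME. [folklore] -/
theorem spreadGenericRung_of_ports (hV : VeryNearCutClasses.VeryNearExit) (hD : DeltaPackageExit)
    (hU : UniformCurvePackageExit) (hR : RelCurvePackageExit) (hN : NormalConeJumpExit)
    (hM : MonomialPinchExit) (hC : FlatConeExit) (hGE : GrandExit) (hSE : SplitConeExit)
    (hJE : JetCylinderExit) (hX : MaxContactCut.MaxOrderThreefoldResolution) (hΓE : SpreadExit)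
    (hP : ∀ n : ℕ, 2 ≤ n → CurvePackagePort n) (h1 : FaceFormCutClasses.OrderOneContact) : SpreadGenericRung :=
  spreadGenericRung_of_engines hV hD hU hR hN hM hC hGE hSE (cylinderExit_of_ports hJE hX) hJE hΓE hP h1

/-- `RungOne` BY NAME from the engines, the ports and the located residual. [folklore] -/
theorem closes_of_engines (hV : VeryNearCutClasses.VeryNearExit) (hD : DeltaPackageExit)
    (hU : UniformCurvePackageExit) (hR : RelCurvePackageExit) (hN : NormalConeJumpExit)
    (hM : MonomialPinchExit) (hC : FlatConeExit) (hGE : GrandExit) (hSE : SplitConeExit)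
    (hJE : JetCylinderExit) (hX : MaxContactCut.MaxOrderThreefoldResolution) (hΓE : SpreadExit)
    (hP : ∀ n : ℕ, 2 ≤ n → CurvePackagePort n) (h1 : FaceFormCutClasses.OrderOneContact)
    (hS : SpreadSpecialRung) : MaxContactCut.RungOne :=
  closes (spreadGenericRung_of_ports hV hD hU hR hN hM hC hGE hSE hJE hX hΓE hP h1) hS

/-- **EXACT RE-LOCATION OF g18's `Cyl.CylSpecialRung`** (the located residual the instruction names): modulo the
spread decided half,
`Cyl.CylSpecialRung ⟺ SpreadSpecialRung`. [folklore] -/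
theorem cylSpecialRung_iff_spreadSpecialRung (hG : SpreadGenericRung) : Cyl.CylSpecialRung ↔ SpreadSpecialRung :=
  Cyl.cylSpecialRung_iff.trans (Leaf.specialRung_iff_of_le cylLeaf_le_spreadLeaf hG)

/-- **EXACT RE-LOCATION OF g17's `Split.SplitSpecialRung`**: modulo the spread decided half, `Split.SplitSpecialRung
⟺ SpreadSpecialRung`.
[folklore] -/
theorem splitSpecialRung_iff_spreadSpecialRung (hG : SpreadGenericRung) : Split.SplitSpecialRung ↔ SpreadSpecialRung :=
  Split.splitSpecialRung_iff.trans (Leaf.specialRung_iff_of_le splitLeaf_le_spreadLeaf hG)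

/-- **EXACT RE-LOCATION OF g16's `Grand.GrandSpecialRung`**: modulo the spread decided half, `Grand.GrandSpecialRung
⟺ SpreadSpecialRung`.
[folklore] -/
theorem grandSpecialRung_iff_spreadSpecialRung (hG : SpreadGenericRung) : Grand.GrandSpecialRung ↔ SpreadSpecialRung :=
  Grand.grandSpecialRung_iff.trans (Leaf.specialRung_iff_of_le grandLeaf_le_spreadLeaf hG)

/-- **EXACT RE-LOCATION OF g15's `Vast.VastSpecialRung`**: modulo the spread decided half, `Vast.VastSpecialRung ⟺
SpreadSpecialRung`.
[folklore] -/
theorem vastSpecialRung_iff_spreadSpecialRung (hG : SpreadGenericRung) : Vast.VastSpecialRung ↔ SpreadSpecialRung :=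
  vastSpecialRung_iff.trans (Leaf.specialRung_iff_of_le vastLeaf_le_spreadLeaf hG)

/-- **EXACT RE-LOCATION OF THE TREE ASIDE 33866** `MaxContactCut.LeafSpecialRung` BY NAME: modulo the spread decided half,
`LeafSpecialRung ⟺ SpreadSpecialRung`. [folklore] -/
theorem leafSpecialRung_iff_spreadSpecialRung (hG : SpreadGenericRung) : MaxContactCut.LeafSpecialRung ↔ SpreadSpecialRung :=
  Leaf.leafSpecialRung_iff_specialRung (L := spreadLeaf) hG

/-- The tree aside 33865 `MaxContactCut.LeafGenericRung` BY NAME from the spread decided half. [folklore] -/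
theorem leafGenericRung_of_spreadGenericRung (hG : SpreadGenericRung) : MaxContactCut.LeafGenericRung :=
  Leaf.leafGenericRung_of_genericRung (L := spreadLeaf) hG

/-- **EXACT RE-LOCATION OF g14's `PinchSpecialRung`**: modulo the spread decided half, `PinchSpecialRung ⟺ SpreadSpecialRung`.
[folklore] -/
theorem pinchSpecialRung_iff_spreadSpecialRung (hG : SpreadGenericRung) : PinchSpecialRung ↔ SpreadSpecialRung :=
  pinchSpecialRung_iff.trans (Leaf.specialRung_iff_of_le pinchLeaf_le_spreadLeaf hG)

/-- `RungOne` BY NAME from the spread decided half and g18's residual (the old residual still closes). [folklore] -/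
theorem closes_of_cylSpecialRung (hG : SpreadGenericRung) (hS : Cyl.CylSpecialRung) : MaxContactCut.RungOne :=
  closes hG (spreadSpecialRung_of_cylSpecialRung hS)

/-- The g18 node's `closes` is RECOVERED from the spread halves plus engine-free monotonicity (nothing of g18 is
lost). [folklore] -/
theorem cyl_closes_of_spread (hG : SpreadGenericRung) (hS : SpreadSpecialRung) : MaxContactCut.RungOne :=
  Cyl.closes (cylGenericRung_of_spreadGenericRung hG) ((cylSpecialRung_iff_spreadSpecialRung hG).mpr hS)

end Kernels

end Spread

end Summit.ResolutionOfSingularities.ResolutionOfSingularities.Theorems.SpreadCut
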